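import Mathlib.NumberTheory.Cyclotomic.Basic
import Literature.NumberTheory.GaloisRepresentations.ArtinRestriction
import Literature.NumberTheory.Automorphic.TotallyRealModularity
import Literature.NumberTheory.Automorphic.BCDTModularity
import HarnessLib

/-!
# Freitas–Le Hung–Siksek 2015, Theorem 5: the printed reduction to Theorems 3–4 and to the
# finiteness of the small-image `j`-invariants (Prop. 3.1 + the 27 curves `X(u,v,w)` + Faltings)

Topic `Literature/NumberTheory/Automorphic`; companion of `TotallyRealModularity.lean`, which
vendors N. Freitas, B. V. Le Hung, S. Siksek, *Elliptic curves over real quadratic fields are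
modular*, Invent. Math. 201 (2015) 159–206 = arXiv:1310.7088 [FreitasLeHungSiksek2015], Thm. 5,
as the named fact `Literature.NumberTheory.Automorphic.FLS2015_theorem5` ("Let `K` be a totally
real field. All but finitely many `K̄`-isomorphism classes of elliptic curves over `K` are
modular"). This file carries **no named fact** and does **not** discharge `FLS2015_theorem5`
(triage XL, see below); it types the one hypothesis of the source's Theorems 2–4 that the tree
lacked — condition (ii) of Thm. 2, "`ρ̄_{E,p}(G_{K(ζ_p)})` is absolutely irreducible" — on the
tree's carriers (`ModPGaloisRep`, `WeierstrassCurve.IsTorsionGaloisRep`,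
`FramedGaloisRep.restrictField`, Mathlib `IsCyclotomicExtension`), proves Prop. 3.1 (i) of the source (`ρ̄(G_{K(ζ_p)}) = ρ̄(G_K) ∩ SL₂(𝔽_p)`, from
`det ρ̄ = χ̄_p`), and proves the assembly of Theorem 5 exactly as printed in §7 of the source from
its two printed ingredients, taken as explicit hypotheses.

## What the source prints (quoted from the held text `paper:arxiv-1310.7088`)

* **Theorem 2** (p. 4 of the text): "Let `E` be an elliptic curve over a totally real number field
  `K`, and let `p ≠ 2` be a rational prime. Write `ρ̄ = ρ̄_{E,p}`. Suppose (i) `ρ̄` is modular,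
  (ii) `ρ̄(G_{K(ζ_p)})` is absolutely irreducible. Then `E` is modular."
* **Theorem 3** (p. 4): "Let `p = 3` or `5`. Let `E` be an elliptic curve over a totally real field
  `K`. Suppose that `ρ̄_{E,p}(G_{K(ζ_p)})` is absolutely irreducible. Then `E` is modular."
  **Theorem 4** (p. 5): the same with `p = 7`.
* p. 5: "Thanks to the addition of Theorem 4, an elliptic curve `E` over a totally real field `K`
  is modular except possibly if the images `ρ̄_{E,p}(G_{K(ζ_p)})` are simultaneously absolutely
  reducible for `p = 3, 5, 7`. In Section 7 we show that such an elliptic curve gives rise to a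
  `K`-point on one of 27 modular curves `X(u,v,w)`, `u ∈ {b3, s3, ns3}`, `v ∈ {b5, s5, ns5}`,
  `w ∈ {b7, s7, ns7}` … The curves … all have genera `> 1`, and so by Faltings' Theorem possess
  only finitely many `K`-points."  **Theorem 5.** "Let `K` be a totally real field. All but
  finitely many `K̄`-isomorphism classes of elliptic curves over `K` are modular."
* **Proposition 3.1** (p. 10): "Let `E` be an elliptic curve over a totally real field `K`. Let
  `p ≥ 3` be a rational prime, and write `ρ̄ = ρ̄_{E,p}`. Then (i)
  `ρ̄(G_{K(ζ_p)}) = ρ̄(G_K) ∩ SL₂(𝔽_p)`. (ii) If `ρ̄(G_{K(ζ_p)})` is absolutely reducible, then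
  `ρ̄(G_K)` is contained either in a Borel subgroup, or in the normalizer of a Cartan subgroup. In
  this case `E` gives rise to a non-cuspidal `K`-point on `X(bp)`, `X(sp)` or `X(nsp)`." Proof of
  (i): "The determinant of `ρ̄` is the mod `p` cyclotomic character … The first part follows
  immediately." ((ii) rests on Dickson's classification, [Swinnerton-Dyer]; not formalised.)
* **§7, proof of Theorem 5** (p. 17 of the text, complete): "Let `K` be a totally real field and
  `E` an elliptic curve over `K`. By Theorems 3 and 4 we know that `E` is modular except possibly
  if `ρ̄_{E,p}(G_{K(ζ_p)})` is simultaneously absolutely reducible for `p = 3, 5, 7`. It follows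
  from Proposition 3.1 that such `E` gives rise to a `K`-point on one of the 27 modular curves in
  (3). These all have genera `> 1`, and so by Faltings' Theorem at most finitely many `K`-points.
  Theorem 5 follows immediately."  (§2, p. 9: "if `E/K` gives rise to the `K`-point `P` on `X(H)`
  then `j(P)` is the `j`-invariant of `E`" — so the exceptional curves have finitely many
  `j`-invariants, i.e. lie in finitely many `K̄`-isomorphism classes.)

## Contents

* `ModPImageAbsIrreducibleOverCyclotomic E p` (**definition**), for a Weierstrass curve `E` over a
  field `K` and a prime `p`: condition (ii) of Thm. 2 — for every framing `ρ̄ : Γ_K →ₜ* GL₂(𝔽_p)`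
  of the `p`-torsion representation of `E` (`WeierstrassCurve.IsTorsionGaloisRep`, file
  `BCDTModularity`) and every model `L` of `K(ζ_p)` (`IsCyclotomicExtension {p} K L`), the
  restriction `ρ̄|_{Γ_L}` (`FramedGaloisRep.restrictField`) is absolutely irreducible
  (`FramedRep.IsAbsolutelyIrreducible`). All framings are `GL₂(𝔽_p)`-conjugate and all models of
  `K(ζ_p)` are `K`-isomorphic, so the universal quantifiers only avoid choices (same convention as
  `ModPGaloisRep.IsAbsIrreducibleOverSqrt` of `BCDTModularity`, the hypothesis of CDT Thm. 7.2.4).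
* `ModPImageAbsIrreducibleOverCyclotomic.isAbsolutelyIrreducible` (proved API): condition (ii)
  implies that `ρ̄_{E,p}` itself is absolutely irreducible (restriction to a subgroup; model
  `CyclotomicField p K`).
* **Prop. 3.1 (i) of the source, proved**: `mem_range_absGaloisRestrict_cyclotomic_iff` — for a
  model `L` of `K(ζ_p)`, `γ ∈ Γ_K` lies in the image of `Γ_L → Γ_K` iff `χ̄_p(γ) = 1` (the image
  is `Gal(K̄/e(L))`, `exists_mem_range_absGaloisRestrict_iff` of `ArtinRestriction`, and
  `e(L) = K(μ_p(K̄))`); hence `range_restrictField_cyclotomic_eq_of_det` — for any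
  `ρ̄ : Γ_K →ₜ* GL_n(𝔽_p)` with `det ρ̄ = χ̄_p`, `ρ̄(G_{K(ζ_p)}) = ρ̄(G_K) ∩ SL_n(𝔽_p)` — and
  `range_restrictField_cyclotomic_eq_of_isTorsionGaloisRep`, the printed "(i)
  `ρ̄(G_{K(ζ_p)}) = ρ̄(G_K) ∩ SL₂(𝔽_p)`" for `ρ̄ = ρ̄_{E,p}`, granted `det ρ̄_{E,p} = χ̄_p` (Weil
  pairing; the tree's named fact `WeierstrassCurve.det_eq_modPCyclotomicCharacter_of_isTorsionGaloisRep`,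
  threaded as the hypothesis `hdet`, exactly as `BCDT.isModular_of_theoremB` does).
* `FLS2015_theorem5_of_largeImage` (**proved**, the printed §7): `FLS2015_theorem5` follows from
  (A) Theorems 3 and 4 — for `K` totally real, `E / 𝓞 K` with `Δ ≠ 0` and `p ∈ {3, 5, 7}` with
  `ρ̄_{E,p}(G_{K(ζ_p)})` absolutely irreducible, `E` is modular (`IsAutomorphicOfWeightZero E`, the
  rendering of "modular" of `TotallyRealModularity`) — and (B) the finiteness statement proved in
  §7 from Prop. 3.1, the 27 curves `X(u,v,w)` of genus `> 1` and Faltings' theorem — for `K`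
  totally real the `j`-invariants of the `E / 𝓞 K` (`Δ ≠ 0`) with `ρ̄_{E,p}(G_{K(ζ_p)})`
  absolutely reducible for `p = 3, 5, 7` simultaneously form a finite set. Both (A) and (B) are
  HYPOTHESES here, not named facts: neither has a proof path in the tree today.

## Why `FLS2015_theorem5_holds` is not landed (triage XL, 2026-08-15)

The printed proof rests on: Thm. 2 (modularity lifting: Breuil–Diamond Thm. 3.2.2, after Kisin,
Gee, Barnet-Lamb–Gee–Geraghty; §1.1 of the source adds a Taylor–Wiles-prime argument for `p = 5`);
Thm. 6 (Langlands–Tunnell ⇒ `ρ̄_{E,3}` modular); the 3–5 and 3–7 modularity switching of §§5–6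
(twisted modular curves `X_E(5) ≅ ℙ¹`, `X_E(7)`, Hilbert irreducibility); Prop. 3.1 / Lemma 3.2
(`det ρ̄ = χ_p` and Dickson's classification of subgroups of `GL₂(𝔽_p)`); the moduli
interpretation of the modular curves `X(H)` over number fields (§2); the genera of the 27 curves;
and Faltings' theorem. Of these only Faltings' theorem has a carrier in the tree — the unproved
named facts `Literature.NumberTheory.DiophantineGeometry.finite_algPoints_of_two_le_genus` /
`finite_ratPlaces_of_two_le_genus` (abc.S14) — and residual modularity of Hilbert eigenforms
("`ρ̄` is modular" over `K ≠ ℚ`), deformation theory and modular curves with level structure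
have none (over `ℚ` the analogous inputs `BCDT.theoremB`, `BCDT.CDT_theorem_7_2_4` are themselves
named facts). No new named fact is introduced here (D-0026); (A) and (B) stay hypotheses until
their carriers exist.

## References

* [FreitasLeHungSiksek2015] N. Freitas, B. V. Le Hung, S. Siksek, Invent. Math. 201 (2015)
  159–206, Thms. 2–5, Prop. 3.1, §7 — held `paper:arxiv-1310.7088`, pp. 4–5, 9–10, 17 of the text.
* [BCDTJAMS2001] (carriers `IsTorsionGaloisRep`, `IsAbsIrreducibleOverSqrt`, file `BCDTModularity`);
  G. Faltings, Invent. Math. 73 (1983), Satz 7 [Faltings1983Endlichkeit] (ingredient of (B)).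
-/

open scoped NumberField IntermediateField MatrixGroups
open NumberField Field Literature.NumberTheory.GaloisRepresentations

noncomputable section

namespace Literature.NumberTheory.Automorphic

universe u v

/-! ### Condition (ii) of FLS Theorem 2: `ρ̄_{E,p}(G_{K(ζ_p)})` absolutely irreducible -/

/-- **`ρ̄_{E,p}(G_{K(ζ_p)})` is absolutely irreducible** — hypothesis (ii) of Freitas–Le Hung–Siksek
2015, Thm. 2, and the hypothesis of their Thms. 3 (`p = 3, 5`) and 4 (`p = 7`): for the elliptic
curve `E / K` and the prime `p`, the image of the absolute Galois group of `K(ζ_p)` under the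
mod-`p` representation `ρ̄_{E,p} : G_K → Aut(E[p]) ≅ GL₂(𝔽_p)` acts absolutely irreducibly on
`𝔽_p²`. Rendered on the tree's carriers: for every framing `ρ̄ : Γ_K →ₜ* GL₂(ZMod p)` of the
Galois action on the geometric `p`-torsion of `E` (`WeierstrassCurve.IsTorsionGaloisRep E p ρ̄`)
and every model `L ⊇ K` of `K(ζ_p)` (`IsCyclotomicExtension {p} K L`), the restriction
`ρ̄|_{Γ_L}` (`FramedGaloisRep.restrictField L ρ̄`, along the chosen `Γ_L → Γ_K`, image
`G_{K(ζ_p)}` up to conjugacy) is absolutely irreducible (`FramedRep.IsAbsolutelyIrreducible`).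
Framings are conjugate and models isomorphic, so the quantifiers only avoid choices (convention of
`ModPGaloisRep.IsAbsIrreducibleOverSqrt`). By Prop. 3.1 (i) of the source the image of `Γ_L` is
`ρ̄(G_K) ∩ SL₂(𝔽_p)` (`range_restrictField_cyclotomic_eq_of_isTorsionGaloisRep` below).
[cite: FreitasLeHungSiksek2015, Thm. 2 (ii) and Prop. 3.1] -/
def ModPImageAbsIrreducibleOverCyclotomic {K : Type u} [Field K] (E : WeierstrassCurve K) (p : ℕ)
    [Fact p.Prime] : Prop :=
  ∀ ρ : ModPGaloisRep K (ZMod p) 2, E.IsTorsionGaloisRep p ρ →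
    ∀ (L : Type u) [Field L] [Algebra K L] [IsCyclotomicExtension {p} K L],
      FramedRep.IsAbsolutelyIrreducible (FramedGaloisRep.restrictField L ρ)

/-- Condition (ii) of FLS Thm. 2 implies that `ρ̄_{E,p}` itself is absolutely irreducible, for
every framing (restrict to the subgroup `G_{K(ζ_p)}`: `IsAbsolutelyIrreducible.of_restrictField`
at Mathlib's model `CyclotomicField p K` of `K(ζ_p)`; `p ≠ 0` in `K` of characteristic `0`).
[cite: FreitasLeHungSiksek2015, Prop. 3.1] -/
theorem ModPImageAbsIrreducibleOverCyclotomic.isAbsolutelyIrreducible {K : Type u} [Field K]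
    [CharZero K] {E : WeierstrassCurve K} {p : ℕ} [Fact p.Prime]
    (h : ModPImageAbsIrreducibleOverCyclotomic E p) {ρ : ModPGaloisRep K (ZMod p) 2}
    (hρ : E.IsTorsionGaloisRep p ρ) : FramedRep.IsAbsolutelyIrreducible ρ := by
  haveI : NeZero ((p : ℕ) : K) := ⟨Nat.cast_ne_zero.2 (Fact.out : p.Prime).ne_zero⟩
  exact FramedGaloisRep.IsAbsolutelyIrreducible.of_restrictField (CyclotomicField p K) ρ
    (h ρ hρ (CyclotomicField p K))

/-! ### Proposition 3.1 (i): `ρ̄(G_{K(ζ_p)}) = ρ̄(G_K) ∩ SL₂(𝔽_p)` -/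

/-- **`Γ_{K(ζ_p)}` inside `Γ_K` is the kernel of the mod-`p` cyclotomic character.** For a field
`K` with `p ≠ char K` and a model `L` of `K(ζ_p)` (`IsCyclotomicExtension {p} K L`), an element
`γ ∈ Γ_K` lies in the image of the restriction map `Γ_L → Γ_K` (`absGaloisRestrict K L`, i.e. in
`Gal(K̄/e(L))` for the induced embedding `e : L → K̄`, `exists_mem_range_absGaloisRestrict_iff`)
iff `χ̄_p(γ) = 1` (`modPCyclotomicCharacterZMod`): `e(L) = K(μ_p(K̄))` and `γ ζ = ζ^{χ̄_p(γ)}`.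
The Galois-theoretic content of Freitas–Le Hung–Siksek 2015, Prop. 3.1 (i).
[cite: FreitasLeHungSiksek2015, Prop. 3.1 (i)] -/
theorem mem_range_absGaloisRestrict_cyclotomic_iff {K : Type u} [Field K] (p : ℕ) [Fact p.Prime]
    [NeZero (p : K)] (L : Type v) [Field L] [Algebra K L] [IsCyclotomicExtension {p} K L]
    (γ : absoluteGaloisGroup K) :
    γ ∈ (absGaloisRestrict K L).range ↔ modPCyclotomicCharacterZMod K p γ = 1 := by
  haveI : FiniteDimensional K L := IsCyclotomicExtension.finiteDimensional {p} K L
  haveI : Algebra.IsAlgebraic K L := Algebra.IsAlgebraic.of_finite K L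
  obtain ⟨e, he⟩ := exists_mem_range_absGaloisRestrict_iff K L
  have hp0 : (p : ℕ) ≠ 0 := (Fact.out : p.Prime).ne_zero
  obtain ⟨ζ, hζ⟩ := IsCyclotomicExtension.exists_isPrimitiveRoot K L (Set.mem_singleton p) hp0
  have hζ' : IsPrimitiveRoot (e ζ) p := hζ.map_of_injective e.toRingHom.injective
  -- `γ` as a `K`-algebra automorphism of `K̄` (the identity identification)
  set γ' : AlgebraicClosure K ≃ₐ[K] AlgebraicClosure K := absoluteGaloisGroup.toAlgEquiv K γ
    with hγ'_def
  have hγ' : ∀ t : AlgebraicClosure K, γ • t = γ' t := fun _ => rfl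
  -- an automorphism fixing `t` fixes it through all its powers
  have hstab : ∀ t : AlgebraicClosure K, γ' t = t → ∀ f ∈ Subgroup.zpowers γ', f t = t :=
    fun t ht f hf => by
      have hf' : f ∈ MulAction.stabilizer (AlgebraicClosure K ≃ₐ[K] AlgebraicClosure K) t :=
        (Subgroup.zpowers_le.2
          (show γ' ∈ MulAction.stabilizer (AlgebraicClosure K ≃ₐ[K] AlgebraicClosure K) t
            from ht)) hf
      exact hf'
  have hfixed : ∀ t : AlgebraicClosure K, γ' t = t →
      t ∈ IntermediateField.fixedField (Subgroup.zpowers γ') := fun t ht => by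
    rw [IntermediateField.mem_fixedField_iff]
    exact hstab t ht
  rw [he γ]
  constructor
  · -- `γ` fixes `e(L) ∋ e(ζ)`, a primitive `p`-th root of unity, so `χ̄_p(γ) = 1`
    intro hfix
    refine modPCyclotomicCharacterZMod_eq_one_of_mem_fixingSubgroup K p hζ' γ ?_
    change γ' ∈ K⟮e ζ⟯.fixingSubgroup
    rw [IntermediateField.mem_fixingSubgroup_iff]
    have h1 : K⟮e ζ⟯ ≤ IntermediateField.fixedField (Subgroup.zpowers γ') :=
      IntermediateField.adjoin_simple_le_iff.2 (hfixed (e ζ) ((hγ' _).symm.trans (hfix ζ)))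
    intro x hx
    exact (IntermediateField.mem_fixedField_iff _ _).1 (h1 hx) γ' (Subgroup.mem_zpowers γ')
  · -- `χ̄_p(γ) = 1`: `γ` fixes `μ_p(K̄)`, which generates `e(L)` over `K`
    intro hχ x
    have hroots : ∀ t : AlgebraicClosure K, t ^ p = 1 → γ' t = t := fun t ht => by
      rw [← hγ', modPCyclotomicCharacterZMod_spec K p γ t ht, hχ, Units.val_one, ZMod.val_one,
        pow_one]
    have hgen : Algebra.adjoin K {b : L | ∃ n : ℕ, n ∈ ({p} : Set ℕ) ∧ n ≠ 0 ∧ b ^ n = 1} ≤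
        (IntermediateField.fixedField (Subgroup.zpowers γ')).toSubalgebra.comap e := by
      rw [Algebra.adjoin_le_iff]
      rintro b ⟨n, hn, -, hb⟩
      rw [Set.mem_singleton_iff] at hn
      subst hn
      exact hfixed (e b) (hroots (e b) (by rw [← map_pow, hb, map_one]))
    have hx : e x ∈ IntermediateField.fixedField (Subgroup.zpowers γ') :=
      hgen (IsCyclotomicExtension.adjoin_roots (S := {p}) (A := K) (B := L) x)
    rw [IntermediateField.mem_fixedField_iff] at hx
    rw [hγ']
    exact hx γ' (Subgroup.mem_zpowers γ')

/-- **Freitas–Le Hung–Siksek 2015, Prop. 3.1 (i), for any `ρ̄` with cyclotomic determinant.** Let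
`ρ̄ : Γ_K →ₜ* GL_n(𝔽_p)` (`p ≠ char K`) have determinant the mod-`p` cyclotomic character. Then for
every model `L` of `K(ζ_p)` the image of `Γ_{K(ζ_p)}` is the determinant-one part of the image of
`Γ_K`: `ρ̄(G_{K(ζ_p)}) = ρ̄(G_K) ∩ SL_n(𝔽_p)` ("The determinant of `ρ̄` is the mod `p` cyclotomic
character … The first part follows immediately").
[cite: FreitasLeHungSiksek2015, Prop. 3.1 (i)] -/
theorem range_restrictField_cyclotomic_eq_of_det {K : Type u} [Field K] {p : ℕ} [Fact p.Prime]
    [NeZero (p : K)] {n : ℕ} (ρ : FramedGaloisRep K (ZMod p) n)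
    (hdet : ∀ σ, Matrix.GeneralLinearGroup.det (ρ σ) = modPCyclotomicCharacterZMod K p σ)
    (L : Type v) [Field L] [Algebra K L] [IsCyclotomicExtension {p} K L] :
    (FramedGaloisRep.restrictField L ρ).toMonoidHom.range =
      ρ.toMonoidHom.range ⊓
        (Matrix.GeneralLinearGroup.det : GL (Fin n) (ZMod p) →* (ZMod p)ˣ).ker := by
  ext x
  constructor
  · rintro ⟨τ, rfl⟩
    refine Subgroup.mem_inf.2 ⟨⟨absGaloisRestrict K L τ, rfl⟩, ?_⟩
    rw [MonoidHom.mem_ker]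
    change Matrix.GeneralLinearGroup.det (ρ (absGaloisRestrict K L τ)) = 1
    rw [hdet]
    exact (mem_range_absGaloisRestrict_cyclotomic_iff p L _).1 ⟨τ, rfl⟩
  · intro hx
    obtain ⟨⟨γ, rfl⟩, hx⟩ := Subgroup.mem_inf.1 hx
    rw [MonoidHom.mem_ker] at hx
    change Matrix.GeneralLinearGroup.det (ρ γ) = 1 at hx
    rw [hdet] at hx
    obtain ⟨τ, hτ⟩ := (mem_range_absGaloisRestrict_cyclotomic_iff p L γ).2 hx
    exact ⟨τ, by rw [← hτ]; rfl⟩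

/-- **Freitas–Le Hung–Siksek 2015, Prop. 3.1 (i), for the mod-`p` representation of an elliptic
curve.** Let `E / K` be an elliptic curve over a field of characteristic `0`, `p` a prime and
`ρ̄` a framing of the Galois action on `E[p]` (`IsTorsionGaloisRep`). Granted that `det ρ̄_{E,p}`
is the mod-`p` cyclotomic character (the named fact
`WeierstrassCurve.det_eq_modPCyclotomicCharacter_of_isTorsionGaloisRep E p`, Weil pairing — taken as
the hypothesis `hdet`), `ρ̄(G_{K(ζ_p)}) = ρ̄(G_K) ∩ SL₂(𝔽_p)` for every model `L` of `K(ζ_p)`.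
[cite: FreitasLeHungSiksek2015, Prop. 3.1 (i)] -/
theorem range_restrictField_cyclotomic_eq_of_isTorsionGaloisRep {K : Type u} [Field K]
    [CharZero K] (E : WeierstrassCurve K) [E.IsElliptic] (p : ℕ) [Fact p.Prime]
    (hdet : E.det_eq_modPCyclotomicCharacter_of_isTorsionGaloisRep p)
    {ρ : ModPGaloisRep K (ZMod p) 2} (hρ : E.IsTorsionGaloisRep p ρ)
    (L : Type v) [Field L] [Algebra K L] [IsCyclotomicExtension {p} K L] :
    (FramedGaloisRep.restrictField L ρ).toMonoidHom.range =
      ρ.toMonoidHom.range ⊓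
        (Matrix.GeneralLinearGroup.det : GL (Fin 2) (ZMod p) →* (ZMod p)ˣ).ker := by
  haveI : NeZero ((p : ℕ) : K) := ⟨Nat.cast_ne_zero.2 (Fact.out : p.Prime).ne_zero⟩
  exact range_restrictField_cyclotomic_eq_of_det ρ (hdet ρ hρ) L

/-! ### Theorem 5 from Theorems 3–4 and the finiteness of the exceptional `j`-invariants (§7) -/

/-- **Freitas–Le Hung–Siksek 2015, proof of Theorem 5 (§7), as printed.** Assume
(A) [Thm. 3 for `p = 3, 5` and Thm. 4 for `p = 7`, with "modular" rendered as in
`TotallyRealModularity` by `IsAutomorphicOfWeightZero`]: for every totally real number field `K`,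
every integral Weierstrass model `E / 𝓞 K` with `Δ(E) ≠ 0` and every `p ∈ {3, 5, 7}` such that
`ρ̄_{E,p}(G_{K(ζ_p)})` is absolutely irreducible (`ModPImageAbsIrreducibleOverCyclotomic`, for the
curve `E ⊗ K`), `E` is automorphic of weight zero; and
(B) [§7: Prop. 3.1 — such `E` gives a `K`-point on one of the 27 modular curves `X(u,v,w)` of (3),
all of genus `> 1` — and Faltings' theorem, with `j(P) = j(E)` (§2)]: for every totally real number
field `K` there is a finite set `S ⊆ K` containing the `j`-invariant `c₄³/Δ` of every `E / 𝓞 K`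
with `Δ(E) ≠ 0` for which `ρ̄_{E,p}(G_{K(ζ_p)})` is absolutely reducible for `p = 3, 5, 7`
simultaneously. Then `FLS2015_theorem5` holds: "by Theorems 3 and 4, `E` is modular except possibly
if `ρ̄_{E,p}(G_{K(ζ_p)})` is simultaneously absolutely reducible for `p = 3, 5, 7` … at most
finitely many `K`-points. Theorem 5 follows immediately." (A) and (B) are hypotheses, not named
facts of the tree (module docstring: no carriers for their proofs); this theorem records that the
vendored `FLS2015_theorem5` is exactly what the printed argument delivers from them.
[cite: FreitasLeHungSiksek2015, §7 (proof of Thm. 5), Thms. 3–4, Prop. 3.1] -/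
theorem FLS2015_theorem5_of_largeImage
    (hA : ∀ (K : Type) [Field K] [NumberField K] [IsTotallyReal K] (E : WeierstrassCurve (𝓞 K)),
      E.Δ ≠ 0 → ∀ (p : ℕ) [Fact p.Prime], (p = 3 ∨ p = 5 ∨ p = 7) →
        ModPImageAbsIrreducibleOverCyclotomic (E.baseChange K) p → IsAutomorphicOfWeightZero E)
    (hB : ∀ (K : Type) [Field K] [NumberField K] [IsTotallyReal K], ∃ S : Finset K,
      ∀ E : WeierstrassCurve (𝓞 K), E.Δ ≠ 0 →
        (∀ (p : ℕ) [Fact p.Prime], (p = 3 ∨ p = 5 ∨ p = 7) →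
          ¬ ModPImageAbsIrreducibleOverCyclotomic (E.baseChange K) p) →
        (algebraMap (𝓞 K) K E.c₄) ^ 3 / algebraMap (𝓞 K) K E.Δ ∈ S) :
    FLS2015_theorem5 := by
  intro K _ _ _
  obtain ⟨S, hS⟩ := hB K
  refine ⟨S, fun E hΔ hj => ?_⟩
  -- Theorems 3–4: `E` is modular unless all three residual images are absolutely reducible …
  by_contra hE
  -- … in which case `j(E)` lies in the finite exceptional set `S` (Prop. 3.1 + Faltings).
  exact hj (hS E hΔ fun p _ hp himg => hE (hA K E hΔ p hp himg))

end Literature.NumberTheory.Automorphic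

end
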